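import Summits.HodgeConjecture.HodgeConjecture.Theorems.VHCAbelianSchemesRoadTracePushforwardCompatOfBricks
import Summits.HodgeConjecture.HodgeConjecture.Theorems.VHCAbelianSchemesRoadIsogenyPushforwardChernCharacter
import HarnessLib

/-!
# Road №4 (`VHCAbelianSchemesRoad`) — the four boundedness witnesses of `TracePushforwardBricks`, PROVED:
# `𝓗om•(E•, F•)`, `𝒪_A[0]` and `Ω^q_A[0]` are bounded complexes of vector bundles

research route conditional on HC_CM; not a corollary; Q11.4-sentence-2 already refuted in dim ≥ 3.

Seat core-w2 (width copy of core-D). Companion of `VHCAbelianSchemesRoadTracePushforwardCompatOfBricks.lean` (p651944): of the data the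
structure `TracePushforwardBricks P E a b hE hE' q α_q` displays, the two `𝓗om•`-boundedness fields (`isBoundedVBComplex_hom₀`,
`isBoundedVBComplex_hom`) — still displayed by core-w1's instance file `…TracePushforwardCompatOfInstances.lean` (p652970, which proves the
two single-complex witnesses `isBoundedVBComplex_unitSingle ∕ _hodgeSingle`) — are THEOREMS, supplied here BY NAME: the internal Hom complex
`𝓗om•(E•, F•)` of two complexes in `[a, b]`, `[c, d]` with finite locally free terms is a bounded complex of vector bundles (its degree-`n`
term is the coproduct `∐_{q+i=n} 𝓗om(E^{-i}, F^q)`, all but finitely many summands zero); also the general single-complex witness.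
`--supports stmt-HodgeConjecture-26512 --as helper`; closes NO stub; nothing here says (TrPair), (SC), (c1), THEOREM T′ or HC_CM holds;
HC_CM HELD, by name only.

* `sigmaIsoBiproductOfIsZero` — a coproduct whose summands off a finite set are zero objects is the finite biproduct of the others;
  `isFiniteLocallyFree_sigmaObj_of_isZero` — hence finite locally free when the summands are;
* `isFiniteLocallyFree_homComplex_X`, **`isBoundedVBComplex_homComplex`** (`= isBoundedVBComplex_homFunctor_obj`);
* `isBoundedVBComplex_single₀` (any vector bundle `M`; the `𝒪[0]` ∕ `Ω^q[0]` cases are core-w1's `isBoundedVBComplex_unitSingle ∕ _hodgeSingle`);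
* `isBoundedVBComplex_hom₀_of_strictly`, `isBoundedVBComplex_hom_twist_of_strictly` — the two `𝓗om•` fields of the bricks in the binders
  of `TracePushforwardCompatPair` (`E•` in `[a, b]` with vector-bundle terms).

References: [cite: StacksProject, Tag 0A8H (Hom complexes)] [cite: Schlichting2011HigherKTheory, §3.1.3 (bounded complexes of vector
bundles)] [cite: BuchweitzFlenner2003, §3]; bookkeeping, no printed statement typed verbatim.
-/

noncomputable section

-- `TopCat.Presheaf`/`Scheme.Modules` are not reducible (as in Mathlib's `AlgebraicGeometry/Modules/Sheaf.lean`).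
set_option backward.isDefEq.respectTransparency false

open CategoryTheory CategoryTheory.Category CategoryTheory.Limits AlgebraicGeometry Opposite

namespace Summit.HodgeConjecture.HodgeConjecture.Ring2.SemiregularRepresentatives

set_option linter.dupNamespace false -- the cell's namespace repeats the summit name, as in every `Ring2*` file

open Literature.AlgebraicGeometry Literature.AlgebraicGeometry.Modules Literature.AlgebraicGeometry.Motives
open Literature.AlgebraicGeometry.Motives.AbelianVariety Literature.AlgebraicGeometry.KTheory
open Summit.Ventures.HSemireg Summit.Ventures.HSemireg.HomComplex

universe u

/-! ## §1 Coproducts with finitely many non-zero summands -/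

section Sigma

variable {X : Scheme.{u}} [HasFiniteBiproducts X.Modules] {J : Type} (F : J → X.Modules) (s : Finset J)


/-- **A coproduct whose summands off a finite set `s` are zero objects is the finite biproduct of the summands on `s`.** [folklore] -/
def sigmaIsoBiproductOfIsZero (hs : ∀ j, j ∉ s → IsZero (F j)) : ∐ F ≅ ⨁ (fun j : s => F j) where
  hom := by
    classical
    exact Sigma.desc fun j => if h : j ∈ s then biproduct.ι (fun j : s => F j) ⟨j, h⟩ else 0
  inv := biproduct.desc fun j => Sigma.ι F j
  hom_inv_id := by
    classical
    refine Sigma.hom_ext _ _ fun j => ?_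
    by_cases h : j ∈ s
    · rw [Sigma.ι_desc_assoc, dif_pos h, biproduct.ι_desc, Category.comp_id]
    · exact (hs j h).eq_of_src _ _
  inv_hom_id := by
    classical
    refine biproduct.hom_ext' _ _ fun j => ?_
    rw [biproduct.ι_desc_assoc, Sigma.ι_desc, Category.comp_id, dif_pos j.2]

/-- **A coproduct of finite locally free modules, all but finitely many of which are zero, is finite locally free.** [folklore] -/
theorem isFiniteLocallyFree_sigmaObj_of_isZero (hs : ∀ j, j ∉ s → IsZero (F j)) (hF : ∀ j, IsFiniteLocallyFree (F j)) :
    IsFiniteLocallyFree (∐ F) :=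
  isFiniteLocallyFree_of_iso (sigmaIsoBiproductOfIsZero F s hs).symm
    (isFiniteLocallyFree_biproduct (fun j : s => F j) fun j => hF j)

end Sigma

/-! ## §2 `𝓗om•(E•, F•)` is a bounded complex of vector bundles -/

section HomComplex

variable {X : Scheme.{u}} (E F : CochainComplex X.Modules ℤ) (a b c d : ℤ)
  [E.IsStrictlyGE a] [E.IsStrictlyLE b] [F.IsStrictlyGE c] [F.IsStrictlyLE d]
  (hE : ∀ p, IsFiniteLocallyFree (E.X p)) (hF : ∀ p, IsFiniteLocallyFree (F.X p))

include a b c d hE hF in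
/-- **The terms `𝓗om•(E•, F•)^n = ∐_{q+i=n} 𝓗om(E^{-i}, F^q)` are finite locally free** for `E•`, `F•` strictly bounded with finite locally
free terms: only the summands with `q ∈ [c, d]`, `-i ∈ [a, b]` are non-zero, and `𝓗om` of vector bundles is a vector bundle.
[cite: StacksProject, Tag 0A8H (Hom complexes)] -/
theorem isFiniteLocallyFree_homComplex_X (n : ℤ) : IsFiniteLocallyFree ((homComplex X E F).X n) := by
  classical
  letI : HasFiniteBiproducts X.Modules := HasFiniteBiproducts.of_hasFiniteProducts
  change IsFiniteLocallyFree (∐ _)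
  -- the finitely many indices `(q, i)` with `q ∈ [c, d]`, `-i ∈ [a, b]`
  have hfin : Set.Finite {j : (ComplexShape.π (ComplexShape.up ℤ) (ComplexShape.up ℤ) (ComplexShape.up ℤ)) ⁻¹' {n} |
      (j : ℤ × ℤ) ∈ Set.Icc c d ×ˢ Set.Icc (-b) (-a)} :=
    ((Set.finite_Icc c d).prod (Set.finite_Icc (-b) (-a))).preimage Subtype.val_injective.injOn
  refine isFiniteLocallyFree_sigmaObj_of_isZero _ hfin.toFinset (fun j hj => ?_) (fun j => ?_)
  · -- off the finite set one of the two factors is a zero object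
    rw [Set.Finite.mem_toFinset, Set.mem_setOf_eq, Set.mem_prod, Set.mem_Icc, Set.mem_Icc] at hj
    change IsZero (sheafHom (E.X (-(j : ℤ × ℤ).2)) (F.X (j : ℤ × ℤ).1))
    by_cases hq : c ≤ (j : ℤ × ℤ).1 ∧ (j : ℤ × ℤ).1 ≤ d
    · have hi : ¬ (-b ≤ (j : ℤ × ℤ).2 ∧ (j : ℤ × ℤ).2 ≤ -a) := fun hi => hj ⟨hq, hi⟩
      rw [not_and_or, not_le, not_le] at hi
      rcases hi with hi | hi
      · exact isZero_sheafHom_of_isZero (E.isZero_of_isStrictlyLE b _ (by lia)) _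
      · exact isZero_sheafHom_of_isZero (E.isZero_of_isStrictlyGE a _ (by lia)) _
    · rw [not_and_or, not_le, not_le] at hq
      rcases hq with hq | hq
      · exact isZero_sheafHom_of_isZero_right X _ (F.isZero_of_isStrictlyGE c _ hq)
      · exact isZero_sheafHom_of_isZero_right X _ (F.isZero_of_isStrictlyLE d _ hq)
  · exact isFiniteLocallyFree_sheafHom' (hE _) (hF _)

include a b c d hE hF in
/-- **`𝓗om•(E•, F•)` is a bounded complex of vector bundles** for `E• ∈ [a, b]`, `F• ∈ [c, d]` with finite locally free terms: it lives in
`[c - b, d - a]` (`HomComplex.isStrictlyGE ∕ isStrictlyLE`) and its terms are vector bundles. [cite: StacksProject, Tag 0A8H (Hom complexes)]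
[cite: Schlichting2011HigherKTheory, §3.1.3] -/
theorem isBoundedVBComplex_homComplex : IsBoundedVBComplex (homComplex X E F) := by
  haveI := HomComplex.isStrictlyGE X E F b c
  haveI := HomComplex.isStrictlyLE X E F a d
  exact isBoundedVBComplex_of_strictly _ (c - b) (d - a) (isFiniteLocallyFree_homComplex_X E F a b c d hE hF)

include a b c d hE hF in
/-- The same for `(homFunctor X E).obj F` (definitionally `homComplex X E F`). [cite: StacksProject, Tag 0A8H (Hom complexes)] -/
theorem isBoundedVBComplex_homFunctor_obj : IsBoundedVBComplex ((homFunctor X E).obj F) :=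
  isBoundedVBComplex_homComplex E F a b c d hE hF

end HomComplex

/-! ## §3 Single complexes of vector bundles -/

section Single

variable {X : Scheme.{u}}

/-- **`M[0]` is a bounded complex of vector bundles for a vector bundle `M`.** [cite: Schlichting2011HigherKTheory, §3.1.3] -/
theorem isBoundedVBComplex_single₀ (M : X.Modules) (hM : IsFiniteLocallyFree M) :
    IsBoundedVBComplex ((HomologicalComplex.single X.Modules (ComplexShape.up ℤ) 0).obj M) :=
  isBoundedVBComplex_of_strictly _ 0 0 fun p => by
    by_cases hp : p = 0
    · subst hp
      exact isFiniteLocallyFree_of_iso (HomologicalComplex.singleObjXSelf (ComplexShape.up ℤ) 0 M).symm hM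
    · exact KZero.isFiniteLocallyFree_of_isZero (HomologicalComplex.isZero_single_obj_X (ComplexShape.up ℤ) 0 M p hp)

end Single

section AbelianVariety

variable {A : AbelianVariety ℂ}

variable (E : CochainComplex A.X.left.Modules ℤ) (a b : ℤ) [E.IsStrictlyGE a] [E.IsStrictlyLE b]
  (hE : ∀ i, IsFiniteLocallyFree (E.X i))

include a b hE in
/-- **`𝓗om•(E•, E•)` is a bounded complex of vector bundles** for `E•` in `[a, b]` with vector-bundle terms — the field
`isBoundedVBComplex_hom₀` of `TracePushforwardBricks`. [cite: StacksProject, Tag 0A8H (Hom complexes)] -/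
theorem isBoundedVBComplex_hom₀_of_strictly : IsBoundedVBComplex ((homFunctor A.X.left E).obj E) :=
  isBoundedVBComplex_homFunctor_obj E E a b a b hE hE

include a b hE in
/-- **`𝓗om•(E•, E• ⊗ Ω^q_A)` is a bounded complex of vector bundles** for `E•` in `[a, b]` with vector-bundle terms — the field
`isBoundedVBComplex_hom` of `TracePushforwardBricks` (`E• ⊗ Ω^q` lives in `[a, b]` termwise, `twistHodgeFunctor` being degreewise).
[cite: StacksProject, Tag 0A8H (Hom complexes)] [cite: Hartshorne1977, II Ex. 5.16] -/
theorem isBoundedVBComplex_hom_twist_of_strictly (q : ℕ) :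
    IsBoundedVBComplex ((homFunctor A.X.left E).obj (twistHodgeComplex A.X q E)) := by
  haveI := A.smoothOfRelativeDimension_dim
  haveI : (twistHodgeComplex A.X q E).IsStrictlyGE a := by
    rw [CochainComplex.isStrictlyGE_iff]
    intro i hi
    exact (twistHodgeFunctor A.X q).map_isZero (E.isZero_of_isStrictlyGE a i hi)
  haveI : (twistHodgeComplex A.X q E).IsStrictlyLE b := by
    rw [CochainComplex.isStrictlyLE_iff]
    intro i hi
    exact (twistHodgeFunctor A.X q).map_isZero (E.isZero_of_isStrictlyLE b i hi)
  exact isBoundedVBComplex_homFunctor_obj E _ a b a b hE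
    (isBoundedVBComplex_twistHodgeComplex A (isBoundedVBComplex_of_strictly E a b hE) q).isFiniteLocallyFree

end AbelianVariety

end Summit.HodgeConjecture.HodgeConjecture.Ring2.SemiregularRepresentatives

end
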